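import Mathlib
import Summits.NavierStokesRegularity.NavierStokesRegularity.Theorems.EulerZoomLiouvillePowerGaugeEulerLiouvilleSelfSimilarKelvinFlowC2
import Literature.Analysis.FluidPDE.DecayingSelfSimilarEulerProfile

/-!
# THE LOCAL CAUCHY FORMULA along lingering backward orbits, and VORTEX-LINE CRUSHING (ROUND-40 seed, nsreg-p2 g33)

THE ONE STATEMENT's needle is a `C²` self-similar Euler profile `(U, P)` (`IsSelfSimilarEulerProfile γ 0 U P`) seen
through `C²` CUT-OFF copies `V` (`‖DV‖ ≤ K`, `V = U` on `ball 0 R_big`), whose backward similarity flow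
`Ψ_σ := Φ^V_{−σ}` is global.  The tree's Cauchy formula `cauchy_formula_flow` (…SelfSimilarSourceExclusion) needs the
profile equation for `V` on ALL of space (`V` smooth); a cut-off copy satisfies it only on the ball.  This file proves the
LOCALISED, `C²` version along orbits that LINGER in `B̄_M ⊂ ball 0 R_big` during `[0, L]` — exactly the orbits the residence
clock `hclock` of `NeedleRace.curl_eq_zero_of_powerClock_of_strongThinExits` is about:

* `hasDerivAt_curl_flow_neg`: `d/dσ Ω(Ψ_σ y) = Ω(Ψ_σ y) − DU(Ψ_σ y)[Ω(Ψ_σ y)]` while `Ψ_σ y ∈ ball 0 R_big`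
  (chain rule + the vorticity profile equation (3.4) `Ω + (W·∇)Ω = (Ω·∇)U`);
* `cauchy_formula_linger` (**local Cauchy formula**): for `σ ∈ [0, L]`,
  `DΨ_σ(y)[Ω(y)] = e^{−(1+γ)σ} · Ω(Ψ_σ y)` — both sides solve `X′ = −(γI + DV(Ψ_σ y))X` on `[0, L]`, `X(0) = Ω(y)`;
* `norm_fderiv_flow_curl_le_linger` (**vortex-line crushing**): with `O := sup_{B̄_M} ‖Ω‖`,
  `‖DΨ_σ(y)[Ω(y)]‖ ≤ e^{−(1+γ)σ}·O`: the material line element that starts along the vorticity of a lingering label is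
  crushed at rate `1+γ`, uniformly over cut-offs, labels and `L` (`norm_fderiv_flow_curl_le_linger'` packages `O`);
* `norm_curl_flow_eq_linger`: conversely `‖Ω(Ψ_σ y)‖ = e^{(1+γ)σ}‖DΨ_σ(y)[Ω(y)]‖`.

Reading (ROUND-39 (K4) made GLOBAL): since `det DΨ_σ = e^{−3γσ}` on lingering orbits (Liouville, `div U = 0`), the
material AREA element orthogonal to `Ω(y)` grows at least like `(‖Ω(y)‖/O)·e^{(1+γ−3γ)σ} = (‖Ω(y)‖/O)·e^{ργσ}`
(`γ = 1/(2+ρ)`) along EVERY lingering vortical orbit — the hovering exponent `ργ` of ROUND-39 is not a property of nodes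
but of residence itself.  Not NS, not E. [cite: ConstantinIgnatovaVicol2026Putative, §3.4.1 eq. (3.23)–(3.24); folklore]
-/

open Set Filter Topology Metric Function MeasureTheory InnerProductSpace
open scoped RealInnerProductSpace NNReal ENNReal

set_option linter.dupNamespace false

namespace Summit.NavierStokesRegularity.NavierStokesRegularity.Theorems.PowerGaugeEulerLiouville.NeedleClock

open Literature.Analysis Literature.Analysis.FluidPDE
open Summit.NavierStokesRegularity.NavierStokesRegularity.Theorems.PowerGaugeEulerLiouville

variable {γ : ℝ} {U V : EuclideanSpace ℝ (Fin 3) → EuclideanSpace ℝ (Fin 3)} {P : EuclideanSpace ℝ (Fin 3) → ℝ}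

/-- On the open ball where the cut-off agrees with the profile, the Jacobians agree. [folklore] -/
theorem fderiv_eq_of_agree_ball {Rbig : ℝ}
    (hVU : ∀ w ∈ ball (0 : EuclideanSpace ℝ (Fin 3)) Rbig, V w = U w) {z : EuclideanSpace ℝ (Fin 3)}
    (hz : z ∈ ball (0 : EuclideanSpace ℝ (Fin 3)) Rbig) : fderiv ℝ V z = fderiv ℝ U z :=
  Filter.EventuallyEq.fderiv_eq (Filter.eventually_of_mem (isOpen_ball.mem_nhds hz) hVU)

/-- **Vorticity along a backward cut-off orbit, inside the ball.**  While `Ψ_σ y ∈ ball 0 R_big` (where `V = U`),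
`d/dσ Ω(Ψ_σ y) = Ω(Ψ_σ y) − DU(Ψ_σ y)[Ω(Ψ_σ y)]`, `Ω = curl U`. [cite: ConstantinIgnatovaVicol2026Putative, §3.1.1 eq. (3.4)] -/
theorem hasDerivAt_curl_flow_neg (hprof : IsSelfSimilarEulerProfile γ 0 U P) (hV : ContDiff ℝ 1 V) {K : ℝ}
    (hK : ∀ y, ‖fderiv ℝ V y‖ ≤ K) {Rbig : ℝ}
    (hVU : ∀ w ∈ ball (0 : EuclideanSpace ℝ (Fin 3)) Rbig, V w = U w) (y : EuclideanSpace ℝ (Fin 3)) {σ : ℝ}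
    (hz : ODE.evolutionMap (fun _ : ℝ => selfSimilarTransport γ 0 V) 0 (-σ) y ∈
      ball (0 : EuclideanSpace ℝ (Fin 3)) Rbig) :
    HasDerivAt (fun r => curl U (ODE.evolutionMap (fun _ : ℝ => selfSimilarTransport γ 0 V) 0 (-r) y))
      (curl U (ODE.evolutionMap (fun _ : ℝ => selfSimilarTransport γ 0 V) 0 (-σ) y) -
        fderiv ℝ U (ODE.evolutionMap (fun _ : ℝ => selfSimilarTransport γ 0 V) 0 (-σ) y)
          (curl U (ODE.evolutionMap (fun _ : ℝ => selfSimilarTransport γ 0 V) 0 (-σ) y))) σ := by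
  set z := ODE.evolutionMap (fun _ : ℝ => selfSimilarTransport γ 0 V) 0 (-σ) y with hzdef
  have hU2 : ContDiff ℝ 2 U := hprof.isSelfSimilarEulerVorticityProfile.contDiff_velocity
  have hcurl : Differentiable ℝ (curl U) := differentiable_curl_of_contDiff hU2
  have h1 := (hcurl z).hasFDerivAt.comp_hasDerivAt σ (C2.Kelvin.hasDerivAt_flow_neg (γ := γ) hV hK y σ)
  have hW : selfSimilarTransport γ 0 V z = γ • (z - 0) + U z := by
    rw [selfSimilarTransport_apply, hVU z hz]
  have hvort := hprof.vorticity_eq_sub_form z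
  have e : fderiv ℝ (curl U) z ((-1 : ℝ) • selfSimilarTransport γ 0 V z) =
      curl U z - fderiv ℝ U z (curl U z) := by
    rw [map_smul, hW]
    have e2 : fderiv ℝ (curl U) z (γ • (z - 0) + U z) = fderiv ℝ U z (curl U z) - curl U z := by
      rw [sub_eq_iff_eq_add.1 hvort]; abel
    rw [e2]; module
  rw [← hzdef] at h1
  rw [e] at h1
  exact h1

/-- **THE LOCAL CAUCHY FORMULA along a lingering backward orbit.**  `V ∈ C²`, `‖DV‖ ≤ K`, `V = U` on `ball 0 R_big`,
`M < R_big`; if `‖Ψ_σ y‖ ≤ M` for `σ ∈ [0, L]` then `DΨ_σ(y)[Ω(y)] = e^{−(1+γ)σ}·Ω(Ψ_σ y)` for `σ ∈ [0, L]`.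
[cite: ConstantinIgnatovaVicol2026Putative, §3.4.1 eq. (3.23)–(3.24)] -/
theorem cauchy_formula_linger (hprof : IsSelfSimilarEulerProfile γ 0 U P) (hV : ContDiff ℝ 2 V) {K : ℝ}
    (hK : ∀ y, ‖fderiv ℝ V y‖ ≤ K) {M Rbig : ℝ} (hMR : M < Rbig)
    (hVU : ∀ w ∈ ball (0 : EuclideanSpace ℝ (Fin 3)) Rbig, V w = U w) {y : EuclideanSpace ℝ (Fin 3)} {L : ℝ}
    (hy : ∀ σ ∈ Icc (0 : ℝ) L, ‖ODE.evolutionMap (fun _ : ℝ => selfSimilarTransport γ 0 V) 0 (-σ) y‖ ≤ M) :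
    ∀ σ ∈ Icc (0 : ℝ) L,
      fderiv ℝ (ODE.evolutionMap (fun _ : ℝ => selfSimilarTransport γ 0 V) 0 (-σ)) y (curl U y) =
        Real.exp (-((1 + γ) * σ)) •
          curl U (ODE.evolutionMap (fun _ : ℝ => selfSimilarTransport γ 0 V) 0 (-σ) y) := by
  have hV1 : ContDiff ℝ 1 V := hV.of_le (by norm_num)
  have hK0 : 0 ≤ K := (norm_nonneg _).trans (hK 0)
  have hzball : ∀ σ ∈ Icc (0 : ℝ) L, ODE.evolutionMap (fun _ : ℝ => selfSimilarTransport γ 0 V) 0 (-σ) y ∈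
      ball (0 : EuclideanSpace ℝ (Fin 3)) Rbig :=
    fun σ hσ => mem_ball_zero_iff.2 (lt_of_le_of_lt (hy σ hσ) hMR)
  -- the linear field `A(t) x = −(γ x + DV(Ψ_t y) x)`
  set A : ℝ → (EuclideanSpace ℝ (Fin 3) →L[ℝ] EuclideanSpace ℝ (Fin 3)) := fun t =>
    -(γ • ContinuousLinearMap.id ℝ (EuclideanSpace ℝ (Fin 3)) +
      fderiv ℝ V (ODE.evolutionMap (fun _ : ℝ => selfSimilarTransport γ 0 V) 0 (-t) y)) with hA
  have hlip : ∀ t ∈ Ico (0 : ℝ) L, LipschitzOnWith (|γ| + K).toNNReal (fun x => A t x) univ := by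
    intro t _
    refine ((A t).lipschitz.weaken ?_).lipschitzOnWith
    rw [← NNReal.coe_le_coe, coe_nnnorm, Real.coe_toNNReal _ (by positivity), hA, norm_neg]
    calc ‖γ • ContinuousLinearMap.id ℝ (EuclideanSpace ℝ (Fin 3)) + fderiv ℝ V _‖
        ≤ ‖γ • ContinuousLinearMap.id ℝ (EuclideanSpace ℝ (Fin 3))‖ + ‖fderiv ℝ V _‖ := norm_add_le _ _
      _ ≤ |γ| + K := by
          refine add_le_add ?_ (hK _)
          rw [norm_smul, Real.norm_eq_abs]
          exact mul_le_of_le_one_right (abs_nonneg γ) ContinuousLinearMap.norm_id_le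
  -- the left-hand side solves `X' = A X` (variational equation, for all `t`)
  set f : ℝ → EuclideanSpace ℝ (Fin 3) := fun r =>
    fderiv ℝ (ODE.evolutionMap (fun _ : ℝ => selfSimilarTransport γ 0 V) 0 (-r)) y (curl U y) with hf
  have hf' : ∀ t, HasDerivAt f (A t (f t)) t := by
    intro t
    have h1 := C2.Kelvin.hasDerivAt_fderiv_flow (γ := γ) hV hK (-t) y
    have h2 : HasDerivAt (fun r : ℝ => -r) (-1 : ℝ) t := hasDerivAt_neg t
    have h3 := (h1.scomp t h2).clm_apply (hasDerivAt_const t (curl U y))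
    simp only [map_zero, add_zero, _root_.smul_apply, ContinuousLinearMap.comp_apply] at h3
    refine h3.congr_deriv ?_
    simp only [hA, hf, _root_.neg_apply, _root_.add_apply, _root_.smul_apply, ContinuousLinearMap.id_apply]
    module
  -- the right-hand side solves it on `[0, L]` (vorticity equation inside the ball)
  set g : ℝ → EuclideanSpace ℝ (Fin 3) := fun r =>
    Real.exp (-((1 + γ) * r)) • curl U (ODE.evolutionMap (fun _ : ℝ => selfSimilarTransport γ 0 V) 0 (-r) y)
    with hg
  have hg' : ∀ t ∈ Icc (0 : ℝ) L, HasDerivAt g (A t (g t)) t := by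
    intro t ht
    have hexp : HasDerivAt (fun r => Real.exp (-((1 + γ) * r))) (Real.exp (-((1 + γ) * t)) * (-(1 + γ))) t := by
      have := ((hasDerivAt_id t).const_mul (1 + γ)).neg.exp
      simpa using this
    have h1 := hexp.smul (hasDerivAt_curl_flow_neg hprof hV1 hK hVU y (hzball t ht))
    refine h1.congr_deriv ?_
    rw [← fderiv_eq_of_agree_ball hVU (hzball t ht)]
    simp only [hA, hg, _root_.neg_apply, _root_.add_apply, _root_.smul_apply, ContinuousLinearMap.id_apply, map_smul,
      smul_sub]
    module
  -- initial values agree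
  have hΦ0 : ODE.evolutionMap (fun _ : ℝ => selfSimilarTransport γ 0 V) 0 0 = id :=
    funext (ODE.evolutionMap_self _ 0)
  have heq : f 0 = g 0 := by
    simp only [hf, hg, neg_zero, mul_zero, Real.exp_zero, one_smul, hΦ0, fderiv_id, ContinuousLinearMap.coe_id',
      id_eq]
  -- uniqueness on `[0, L]`
  by_cases hL : 0 ≤ L
  swap
  · intro σ hσ; exact absurd (hσ.1.trans hσ.2) hL
  have hfc : ContinuousOn f (Icc 0 L) := fun t _ => (hf' t).continuousAt.continuousWithinAt
  have hgc : ContinuousOn g (Icc 0 L) := fun t ht => (hg' t ht).continuousAt.continuousWithinAt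
  have huniq := ODE_solution_unique_of_mem_Icc_right (v := fun t x => A t x) (s := fun _ => univ) (K := (|γ| + K).toNNReal)
    hlip hfc (fun t _ => (hf' t).hasDerivWithinAt) (fun _ _ => mem_univ _) hgc
    (fun t ht => (hg' t (Ico_subset_Icc_self ht)).hasDerivWithinAt) (fun _ _ => mem_univ _) heq
  intro σ hσ
  exact huniq hσ

/-- **Vorticity size along a lingering orbit**: `‖Ω(Ψ_σ y)‖ = e^{(1+γ)σ}‖DΨ_σ(y)[Ω(y)]‖`. [cite: ConstantinIgnatovaVicol2026Putative, §3.4.1 eq. (3.24)] -/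
theorem norm_curl_flow_eq_linger (hprof : IsSelfSimilarEulerProfile γ 0 U P) (hV : ContDiff ℝ 2 V) {K : ℝ}
    (hK : ∀ y, ‖fderiv ℝ V y‖ ≤ K) {M Rbig : ℝ} (hMR : M < Rbig)
    (hVU : ∀ w ∈ ball (0 : EuclideanSpace ℝ (Fin 3)) Rbig, V w = U w) {y : EuclideanSpace ℝ (Fin 3)} {L : ℝ}
    (hy : ∀ σ ∈ Icc (0 : ℝ) L, ‖ODE.evolutionMap (fun _ : ℝ => selfSimilarTransport γ 0 V) 0 (-σ) y‖ ≤ M)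
    {σ : ℝ} (hσ : σ ∈ Icc (0 : ℝ) L) :
    ‖curl U (ODE.evolutionMap (fun _ : ℝ => selfSimilarTransport γ 0 V) 0 (-σ) y)‖ =
      Real.exp ((1 + γ) * σ) *
        ‖fderiv ℝ (ODE.evolutionMap (fun _ : ℝ => selfSimilarTransport γ 0 V) 0 (-σ)) y (curl U y)‖ := by
  rw [cauchy_formula_linger hprof hV hK hMR hVU hy σ hσ, norm_smul, Real.norm_eq_abs, abs_of_pos (Real.exp_pos _),
    ← mul_assoc, ← Real.exp_add]
  simp

/-- **VORTEX-LINE CRUSHING along lingering orbits.**  If `‖Ω‖ ≤ O` on `B̄_M`, then for every label lingering in `B̄_M`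
during `[0, L]`: `‖DΨ_σ(y)[Ω(y)]‖ ≤ e^{−(1+γ)σ}·O`, `σ ∈ [0, L]`. [cite: ConstantinIgnatovaVicol2026Putative, §3.4.1 eq. (3.24)] -/
theorem norm_fderiv_flow_curl_le_linger (hprof : IsSelfSimilarEulerProfile γ 0 U P) (hV : ContDiff ℝ 2 V) {K : ℝ}
    (hK : ∀ y, ‖fderiv ℝ V y‖ ≤ K) {M Rbig : ℝ} (hMR : M < Rbig)
    (hVU : ∀ w ∈ ball (0 : EuclideanSpace ℝ (Fin 3)) Rbig, V w = U w) {O : ℝ}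
    (hO : ∀ z ∈ closedBall (0 : EuclideanSpace ℝ (Fin 3)) M, ‖curl U z‖ ≤ O) {y : EuclideanSpace ℝ (Fin 3)} {L : ℝ}
    (hy : ∀ σ ∈ Icc (0 : ℝ) L, ‖ODE.evolutionMap (fun _ : ℝ => selfSimilarTransport γ 0 V) 0 (-σ) y‖ ≤ M)
    {σ : ℝ} (hσ : σ ∈ Icc (0 : ℝ) L) :
    ‖fderiv ℝ (ODE.evolutionMap (fun _ : ℝ => selfSimilarTransport γ 0 V) 0 (-σ)) y (curl U y)‖ ≤
      Real.exp (-((1 + γ) * σ)) * O := by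
  rw [cauchy_formula_linger hprof hV hK hMR hVU hy σ hσ, norm_smul, Real.norm_eq_abs, abs_of_pos (Real.exp_pos _)]
  exact mul_le_mul_of_nonneg_left (hO _ (mem_closedBall_zero_iff.2 (hy σ hσ))) (Real.exp_pos _).le

/-- **VORTEX-LINE CRUSHING, packaged**: `∃ O ≥ 0` (`= sup_{B̄_M}‖curl U‖`) such that for every `C²` cut-off copy, every
lingering label and every `σ ∈ [0, L]`: `‖DΨ_σ(y)[Ω(y)]‖ ≤ e^{−(1+γ)σ}·O`.  With `det DΨ_σ = e^{−3γσ}` this is the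
GLOBAL form of ROUND-39's hovering exponent: area transverse to `Ω(y)` grows `≥ (‖Ω(y)‖/O)e^{(1−2γ)σ}`. [folklore] -/
theorem norm_fderiv_flow_curl_le_linger' (hprof : IsSelfSimilarEulerProfile γ 0 U P) (M : ℝ) :
    ∃ O : ℝ, 0 ≤ O ∧ ∀ (V : EuclideanSpace ℝ (Fin 3) → EuclideanSpace ℝ (Fin 3)) (K Rbig : ℝ),
      ContDiff ℝ 2 V → (∀ y, ‖fderiv ℝ V y‖ ≤ K) → M < Rbig →
      (∀ w ∈ ball (0 : EuclideanSpace ℝ (Fin 3)) Rbig, V w = U w) →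
      ∀ (y : EuclideanSpace ℝ (Fin 3)) (L : ℝ),
      (∀ σ ∈ Icc (0 : ℝ) L, ‖ODE.evolutionMap (fun _ : ℝ => selfSimilarTransport γ 0 V) 0 (-σ) y‖ ≤ M) →
      ∀ σ ∈ Icc (0 : ℝ) L,
        ‖fderiv ℝ (ODE.evolutionMap (fun _ : ℝ => selfSimilarTransport γ 0 V) 0 (-σ)) y (curl U y)‖ ≤
          Real.exp (-((1 + γ) * σ)) * O := by
  have hU2 : ContDiff ℝ 2 U := hprof.isSelfSimilarEulerVorticityProfile.contDiff_velocity
  obtain ⟨B, hB⟩ := (isCompact_closedBall (0 : EuclideanSpace ℝ (Fin 3)) M).exists_bound_of_continuousOn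
    (differentiable_curl_of_contDiff hU2).continuous.continuousOn
  refine ⟨max B 0, le_max_right _ _, ?_⟩
  intro V K Rbig hV hK hMR hVU y L hy σ hσ
  exact norm_fderiv_flow_curl_le_linger hprof hV hK hMR hVU (fun z hz => (hB z hz).trans (le_max_left _ _)) hy hσ

end Summit.NavierStokesRegularity.NavierStokesRegularity.Theorems.PowerGaugeEulerLiouville.NeedleClock
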